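import Summits.PneNP.PneNP.Theorems.ChebyshevTracialDesignAPrioriPsdExplicit
import HarnessLib

/-!
# Cell pnp-psdrank, route `ChebyshevTracialDesign`: POLYNOMIAL TRACIAL DECAY FOR FREE — the route's balanced designs have tracial value
# `≤ 37·r·n^{−3/2}` on tight psd strategies of EVERY dimension `r`, unconditionally

Harmonic backbone of the crux `TracialDecayExp20` (stmt-PneNP-19878), brick 45h (prover g10): brick 45f's closed-form a-priori bound
specialised to the crux's own hypothesis `IsBalancedDesign n t (Tq n) (dq n) 20 C w`:
* §1 arithmetic of `dq n = ⌊n^{1/4}⌋`: `16·(dq n)² ≤ n` (`n ≥ 256`), `dq n ≥ 18` (`n ≥ 18⁴`), hence `20·dq n + 16 ≤ n`, and the deep tail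
  `(c' + 20)·√P_{dq n} ≤ 1/(n√n)` (`P_D ≤ (4K/n)^K ≤ n^{−5}`, `K = D/2+1 ≥ 10`, `(4K)² ≤ n`; brick 28 `atten_le_pow`);
* §2 **`tracialValueLEAt_threeHalves`** — for every even `n ≥ 18⁴ = 104976`, every balanced exact design `(t, C, w)` of degree `dq n` on levels
  `≤ Tq n` with `Σ|w_c| ≤ 20`, and every `r ≥ 1`: `TracialValueLEAt (levelWeight n t C w) (37/(n·√n)) r`.
  The crux `TracialDecayExp20` asks for `exp(−a·dq n) = exp(−a·n^{1/4})` in place of `37·n^{−3/2}` (for `r²n < e^{a dq n}`); this polynomial rate is what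
  exactness + tightness give with no structure theory at all, at every dimension.
[cite: Grigoriev2001, Lemma 1.4 (PDF p. 8)] [cite: Rothvoss2017, §2 (PDF p. 6)] [cite: GriblingDelaatLaurent2019, §5]
Stature: support/instrument (no defs), UNCONDITIONAL. WHAT THIS IS NOT: not the crux; nothing on psd rank; no P-vs-NP content. Supports stmt-PneNP-19878.
-/

set_option linter.dupNamespace false -- `Summit.PneNP.PneNP.…`: summit = sub-problem (D-0017)

noncomputable section

namespace Summit.PneNP.PneNP.Theorems.ChebyshevTracialDesignThreeHalvesDecay

open Finset Matrix Literature.Barriers.PneNP Literature.Computability.Complexity Literature.Combinatorics.Optimization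
open Summit.PneNP.PneNP.Theorems.ChebyshevTracialDesignAPrioriPsdExplicit (tracialValueLEAt_apriori_explicit)
open Summit.PneNP.PneNP.Theorems.ChebyshevTracialDesignAssembly (tracialValueLEAt_mono)
open Summit.PneNP.PneNP.Theorems.ChebyshevTracialDesignSpectralNonTightnessEstimates (atten_le_pow atten_nonneg)

variable {n : ℕ}

/-! ### §1 Arithmetic of `dq n` and the deep tail -/

/-- `16·(dq n)² ≤ n` for `n ≥ 256` (`(dq n)² ≤ ⌊√n⌋` and `16⌊√n⌋ ≤ n`). -/
theorem sixteen_mul_dq_sq_le (hn : 256 ≤ n) : 16 * (dq n * dq n) ≤ n := by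
  have h1 : dq n * dq n ≤ Nat.sqrt n := Nat.sqrt_le (Nat.sqrt n)
  have h2 : Nat.sqrt n * Nat.sqrt n ≤ n := Nat.sqrt_le n
  have h3 : 16 ≤ Nat.sqrt n := Nat.le_sqrt.2 (by omega)
  calc 16 * (dq n * dq n) ≤ 16 * Nat.sqrt n := Nat.mul_le_mul_left _ h1
    _ ≤ Nat.sqrt n * Nat.sqrt n := Nat.mul_le_mul_right _ h3
    _ ≤ n := h2

/-- `18 ≤ dq n` for `n ≥ 18⁴ = 104976`. -/
theorem eighteen_le_dq (hn : 104976 ≤ n) : 18 ≤ dq n :=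
  Nat.le_sqrt.2 (Nat.le_sqrt.2 (by norm_num; omega))

/-- **The deep tail is below `n^{−3/2}`**: `(c' + 20)·√P_{dq n} ≤ 1/(n√n)` for `n ≥ 18⁴` and `c' ≤ n/4 + … ≤ n − 20`
(`P_D = Π_{i<D/2+1}(2i+1)/(n−2i) ≤ (4K/n)^K ≤ n^{−5}`, `K = dq n/2 + 1`). -/
theorem deep_tail_le {c' : ℕ} (hn : 104976 ≤ n) (hc' : 2 * (2 * c' + 1) + 2 ≤ n) :
    ((c' : ℝ) + 20) * Real.sqrt (∏ i ∈ range (dq n / 2 + 1), ((2 * i + 1 : ℝ) / ((n : ℝ) - 2 * i))) ≤ 1 / ((n : ℝ) * Real.sqrt n) := by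
  have hdq := eighteen_le_dq hn
  have hsq := sixteen_mul_dq_sq_le (n := n) (by omega)
  set K : ℕ := dq n / 2 + 1 with hK
  have hK10 : 10 ≤ K := by omega
  have hKdq : K ≤ dq n := by omega
  have hKK : 16 * (K * K) ≤ n := le_trans (Nat.mul_le_mul_left _ (Nat.mul_le_mul hKdq hKdq)) hsq
  have hn0 : (0 : ℝ) < n := by exact_mod_cast (show 0 < n by omega)
  have hsn : 0 < Real.sqrt n := Real.sqrt_pos.2 hn0
  -- `P ≤ (4K/n)^K ≤ (4K/n)^10 ≤ n^{-5}`
  have hq0 : (0 : ℝ) ≤ 4 * K / n := by positivity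
  have hq1 : (4 * K : ℝ) / n ≤ 1 := by
    rw [div_le_one hn0]; exact_mod_cast (show 4 * K ≤ n by nlinarith)
  have hP : ∏ i ∈ range K, ((2 * i + 1 : ℝ) / ((n : ℝ) - 2 * i)) ≤ 1 / (n : ℝ) ^ 5 := by
    calc _ ≤ ((4 * K : ℝ) / n) ^ K := atten_le_pow (by nlinarith)
      _ ≤ ((4 * K : ℝ) / n) ^ 10 := pow_le_pow_of_le_one hq0 hq1 hK10
      _ = (((4 * K : ℝ) * (4 * K)) / ((n : ℝ) * n)) ^ 5 := by rw [show (10 : ℕ) = 2 * 5 by norm_num, pow_mul]; congr 1; field_simp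
      _ ≤ ((n : ℝ) / ((n : ℝ) * n)) ^ 5 := by
          refine pow_le_pow_left₀ (by positivity) (div_le_div_of_nonneg_right ?_ (by positivity)) 5
          exact_mod_cast (show 4 * K * (4 * K) ≤ n by nlinarith)
      _ = 1 / (n : ℝ) ^ 5 := by rw [div_mul_cancel_left₀ hn0.ne', one_div, inv_pow]
  have hP0 : 0 ≤ ∏ i ∈ range K, ((2 * i + 1 : ℝ) / ((n : ℝ) - 2 * i)) := atten_nonneg (by nlinarith)
  -- `√P ≤ 1/(n²·√n)` and `c' + 20 ≤ n`
  have hsqrtP : Real.sqrt (∏ i ∈ range K, ((2 * i + 1 : ℝ) / ((n : ℝ) - 2 * i))) ≤ 1 / ((n : ℝ) ^ 2 * Real.sqrt n) := by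
    have h5 : (n : ℝ) ^ 5 = ((n : ℝ) ^ 2 * Real.sqrt n) ^ 2 := by
      rw [mul_pow, Real.sq_sqrt hn0.le]; ring
    calc _ ≤ Real.sqrt (1 / (n : ℝ) ^ 5) := Real.sqrt_le_sqrt hP
      _ = 1 / ((n : ℝ) ^ 2 * Real.sqrt n) := by
          rw [h5, Real.sqrt_div' _ (sq_nonneg _), Real.sqrt_one, Real.sqrt_sq (by positivity)]
  have hc20 : ((c' : ℝ) + 20) ≤ n := by exact_mod_cast (show c' + 20 ≤ n by omega)
  calc ((c' : ℝ) + 20) * Real.sqrt (∏ i ∈ range K, ((2 * i + 1 : ℝ) / ((n : ℝ) - 2 * i)))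
      ≤ (n : ℝ) * (1 / ((n : ℝ) ^ 2 * Real.sqrt n)) := mul_le_mul hc20 hsqrtP (Real.sqrt_nonneg _) hn0.le
    _ = 1 / ((n : ℝ) * Real.sqrt n) := by field_simp

/-! ### §2 Polynomial tracial decay at every dimension -/

/-- **POLYNOMIAL TRACIAL DECAY, UNCONDITIONALLY, AT EVERY DIMENSION.** For every even `n ≥ 18⁴ = 104976`, every balanced exact design
`(t, C, w)` of degree `dq n` on levels `≤ Tq n` with `Σ|w_c| ≤ 20` (`IsBalancedDesign n t (Tq n) (dq n) 20 C w`), and every `r ≥ 1`: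
`TracialValueLEAt (levelWeight n t C w) (37/(n·√n)) r`.
[cite: Grigoriev2001, Lemma 1.4 (PDF p. 8)] [cite: Rothvoss2017, §2 (PDF p. 6)] [cite: GriblingDelaatLaurent2019, §5] -/
theorem tracialValueLEAt_threeHalves (hn : 104976 ≤ n) (hev : Even n) (t : ℕ) (C : Finset ℕ) (w : ℕ → ℝ)
    (hdes : IsBalancedDesign n t (Tq n) (dq n) 20 C w) (r : ℕ) (hr : 0 < r) :
    TracialValueLEAt (levelWeight n t C w) (37 / ((n : ℝ) * Real.sqrt n)) r := by
  obtain ⟨hex, hbal⟩ := hdes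
  obtain ⟨c', hc'⟩ := hex.1
  rw [hc'] at hex hbal ⊢
  have ht : 2 * (2 * c' + 1) + 2 ≤ n := hex.2.1
  have hdq := eighteen_le_dq hn
  have hsq := sixteen_mul_dq_sq_le (n := n) (by omega)
  have hDn : 20 * dq n + 16 ≤ n := by nlinarith
  have hD : dq n ≤ 2 * c' := by omega
  have h := tracialValueLEAt_apriori_explicit hev hex hbal hD hDn hr
  refine tracialValueLEAt_mono _ ?_ r h
  have htail := deep_tail_le (c' := c') hn ht
  have hn0 : (0 : ℝ) < n := by exact_mod_cast (show 0 < n by omega)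
  have : (36 : ℝ) / ((n : ℝ) * Real.sqrt n) + 1 / ((n : ℝ) * Real.sqrt n) = 37 / ((n : ℝ) * Real.sqrt n) := by ring
  linarith

end Summit.PneNP.PneNP.Theorems.ChebyshevTracialDesignThreeHalvesDecay
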